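import Literature.RingTheory.MvPowerSeries.MaximalIdealPow
import HarnessLib

/-!
# Expansion transport: two power-series readings of a local ring with PERFECT residue field agree as soon as they agree
# on generators of the maximal ideal and on residues («the completed chart square commutes», finite-level form)

W4.1 support file (crux `Steer`, stmt-ResolutionOfSingularities-16345; line `switching_dichotomy`), res-D-pv-007 AS
res-L0-w41-stub-5 — stage (Tsq) of the Lemma S kernel `…NoSatelliteStep` (plan-1 RULING 147c; companion of stage (R)
`…ChartRealisability`, p537513). In res-L0-w41-idea-3's NT-DIRECT §1 (2)–(3) the element `f₁ ∈ S₁` is read in TWO Cohen models,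
`Ŝ₁ ≃ K⟦x, y, z⟧` and `Ŝ₂ ≃ K⟦x′, y, z′⟧`, and step (γ) needs the chart square «`Ŝ₁ → Ŝ₂` IS the monomial substitution
`x ↦ x′y, y ↦ y, z ↦ z′y`». This file proves the square WITHOUT constructing the completed map `Ŝ₁ → Ŝ₂` and without any
uniqueness of coefficient fields:

**`ringHom_comp_eq_of_generators`.** Let `S` be a local ring with perfect residue field of characteristic `p`,
`E : S →+* K⟦X_σ⟧`, `E′ : S →+* K′⟦X_τ⟧` ring homomorphisms (`K, K′` fields, `char K′ = p`), `θ : K⟦X_σ⟧ →+* K′⟦X_τ⟧` a ring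
homomorphism over a map of constants `lam : K →+* K′` (`θ (C c) = C (lam c)`) sending series without constant term to series
without constant term. If `θ (E g) = E′ g` for `g` in a finite generating set `G` of `𝔪_S` with `E g` constant-free, and the
residues agree (`lam (const (E s)) = const (E′ s)` for all `s`), then `θ ∘ E = E′`.

Proof (`sub_mem_pow`, induction on `N` as in (R)): `s = u^{pⁿ} + Σ_{g ∈ G} g·c_g` (perfect residue field), so
`θ(E s) − E′ s = (θ(E u) − E′ u)^{pⁿ} + Σ_g E′ g · (θ(E c_g) − E′ c_g)` (characteristic `p`, agreement on `G`); the first term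
lies in `𝔪^{pⁿ}` by residue agreement, the second in `𝔪·𝔪^N`. Coefficients below degree `N` of members of `𝔪^N` vanish
(`Jets.coeff_eq_zero_of_mem_maximalIdeal_pow`), so the two series agree coefficientwise.

Elementary [folklore; cite: Matsumura1987, §28 (coefficient fields; this is a finite-level substitute for their functoriality)].
OURS (campaign res-hironaka); nothing here is attributed to [Hironaka2017]. -/

noncomputable section

-- `Summit.<S>.<S>.…` duplicates the summit name by design (single-problem summit).
set_option linter.dupNamespace false

open MvPowerSeries IsLocalRing
open Literature.RingTheory.MvPowerSeries

namespace Summit.ResolutionOfSingularities.ResolutionOfSingularities.Theorems.SwitchingDichotomy.ExpansionTransport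

universe u v v' w w'

variable {S : Type u} [CommRing S] [IsLocalRing S] {σ : Type v} {τ : Type v'} {K : Type w} {K' : Type w'} [Field K] [Field K']
  (p : ℕ) [hp : Fact p.Prime] [CharP K' p]
  (E : S →+* MvPowerSeries σ K) (E' : S →+* MvPowerSeries τ K') (θ : MvPowerSeries σ K →+* MvPowerSeries τ K')
  (lam : K →+* K')

omit hp in
/-- `s ≡ u^{pⁿ} (mod 𝔪)` for some `u`, when the residue field is perfect (copy of the (R)-file lemma, kept local to avoid an
import). [folklore] -/
theorem exists_sub_pow_mem_maximalIdeal' (hperf : ∀ a : ResidueField S, ∃ b : ResidueField S, b ^ p = a) (n : ℕ) (s : S) :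
    ∃ u : S, s - u ^ p ^ n ∈ maximalIdeal S := by
  have hiter : ∀ a : ResidueField S, ∃ b : ResidueField S, b ^ p ^ n = a := by
    intro a
    induction n generalizing a with
    | zero => exact ⟨a, by rw [pow_zero, pow_one]⟩
    | succ n ih =>
      obtain ⟨b, rfl⟩ := hperf a
      obtain ⟨c, rfl⟩ := ih b
      exact ⟨c, by rw [pow_succ, pow_mul]⟩
  obtain ⟨b, hb⟩ := hiter (residue S s)
  obtain ⟨u, rfl⟩ := residue_surjective b
  exact ⟨u, by rw [← residue_eq_zero_iff, map_sub, map_pow, hb, sub_self]⟩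

omit hp [CharP K' p] in
/-- The constant term of `θ F` is `lam` of the constant term of `F`, for `θ` over `lam` preserving constant-free series.
[folklore] -/
theorem constantCoeff_map_eq (hθC : ∀ c : K, θ (C c) = C (lam c))
    (hθm : ∀ F : MvPowerSeries σ K, constantCoeff F = 0 → constantCoeff (θ F) = 0) (F : MvPowerSeries σ K) :
    constantCoeff (θ F) = lam (constantCoeff F) := by
  have hsplit : F = C (constantCoeff F) + (F - C (constantCoeff F)) := by ring
  rw [hsplit, map_add, hθC, map_add, constantCoeff_C,
    hθm _ (by rw [map_sub, constantCoeff_C, sub_self]), add_zero, map_add, constantCoeff_C, map_sub, constantCoeff_C,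
    sub_self, add_zero]

/-- The induction: **`θ(E s) ≡ E′ s (mod 𝔪^N)`** for every `N`. [folklore] -/
theorem sub_mem_pow (hperf : ∀ a : ResidueField S, ∃ b : ResidueField S, b ^ p = a)
    (hθC : ∀ c : K, θ (C c) = C (lam c))
    (hθm : ∀ F : MvPowerSeries σ K, constantCoeff F = 0 → constantCoeff (θ F) = 0)
    (G : Finset S) (hG : Ideal.span (G : Set S) = maximalIdeal S) (hE0 : ∀ g ∈ G, constantCoeff (E g) = 0)
    (hgen : ∀ g ∈ G, θ (E g) = E' g) (hres : ∀ s : S, lam (constantCoeff (E s)) = constantCoeff (E' s))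
    (N : ℕ) (s : S) : θ (E s) - E' s ∈ maximalIdeal (MvPowerSeries τ K') ^ N := by
  classical
  haveI : CharP (MvPowerSeries τ K') p := charP_of_injective_algebraMap (C_injective (σ := τ) (R := K')) p
  induction N generalizing s with
  | zero => rw [pow_zero, Ideal.one_eq_top]; exact Submodule.mem_top
  | succ N ih =>
    set n := N + 1 with hn
    have hpn : N + 1 ≤ p ^ n := (Nat.lt_pow_self hp.out.one_lt).le
    obtain ⟨u, hu⟩ := exists_sub_pow_mem_maximalIdeal' p hperf n s
    rw [← hG, ← Ideal.submodule_span_eq, Submodule.mem_span_finset] at hu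
    obtain ⟨c, -, hc⟩ := hu
    have hs : s = u ^ p ^ n + ∑ g ∈ G, g * c g := by
      rw [← sub_eq_iff_eq_add', ← hc]
      exact Finset.sum_congr rfl fun g _ => by rw [smul_eq_mul, mul_comm]
    -- the key identity
    have hkey : θ (E s) - E' s = (θ (E u) - E' u) ^ p ^ n + ∑ g ∈ G, E' g * (θ (E (c g)) - E' (c g)) := by
      rw [hs, map_add, map_add, map_pow, map_pow, map_sum, map_sum, sub_pow_char_pow, map_add, map_pow, map_sum]
      simp only [map_mul, mul_sub, Finset.sum_sub_distrib]
      have hG' : ∑ g ∈ G, θ (E g) * θ (E (c g)) = ∑ g ∈ G, E' g * θ (E (c g)) :=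
        Finset.sum_congr rfl fun g hg => by rw [hgen g hg]
      rw [hG']
      ring
    rw [hkey]
    refine Ideal.add_mem _ ?_ (Ideal.sum_mem _ fun g hg => ?_)
    · refine Ideal.pow_le_pow_right hpn (Ideal.pow_mem_pow ?_ _)
      rw [Jets.mem_maximalIdeal_iff_constantCoeff_eq_zero, map_sub, constantCoeff_map_eq θ lam hθC hθm, hres, sub_self]
    · rw [pow_succ']
      refine Ideal.mul_mem_mul ?_ (ih (c g))
      rw [Jets.mem_maximalIdeal_iff_constantCoeff_eq_zero, ← hres, hE0 g hg, map_zero]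

/-- **EXPANSION TRANSPORT.** Two power-series readings `E`, `E′` of a local ring with perfect residue field agree — `θ ∘ E = E′` —
as soon as the continuous connecting map `θ` (over `lam` on constants) matches them on a finite generating set of `𝔪` and the
residues match. (Lemma S: `E = φ₁ ∘ (S₁ → Ŝ₁)`, `E′ = φ₂ ∘ (S₁ → S₂ → Ŝ₂)`, `θ` = the `y`-chart monomial substitution over the
residue isomorphism; generators `X ↦ x′y`, `y ↦ y`, `z ↦ z′y`.) [folklore] -/
theorem ringHom_comp_eq_of_generators (hperf : ∀ a : ResidueField S, ∃ b : ResidueField S, b ^ p = a)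
    (hθC : ∀ c : K, θ (C c) = C (lam c))
    (hθm : ∀ F : MvPowerSeries σ K, constantCoeff F = 0 → constantCoeff (θ F) = 0)
    (G : Finset S) (hG : Ideal.span (G : Set S) = maximalIdeal S) (hE0 : ∀ g ∈ G, constantCoeff (E g) = 0)
    (hgen : ∀ g ∈ G, θ (E g) = E' g) (hres : ∀ s : S, lam (constantCoeff (E s)) = constantCoeff (E' s)) :
    θ.comp E = E' := by
  refine RingHom.ext fun s => ?_
  rw [RingHom.comp_apply, ← sub_eq_zero]
  ext e
  rw [map_zero]
  exact Jets.coeff_eq_zero_of_mem_maximalIdeal_pow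
    (sub_mem_pow p E E' θ lam hperf hθC hθm G hG hE0 hgen hres (e.degree + 1) s) (Nat.lt_succ_self _)

/-- Pointwise form of `ringHom_comp_eq_of_generators`. [folklore] -/
theorem map_eq_of_generators (hperf : ∀ a : ResidueField S, ∃ b : ResidueField S, b ^ p = a)
    (hθC : ∀ c : K, θ (C c) = C (lam c))
    (hθm : ∀ F : MvPowerSeries σ K, constantCoeff F = 0 → constantCoeff (θ F) = 0)
    (G : Finset S) (hG : Ideal.span (G : Set S) = maximalIdeal S) (hE0 : ∀ g ∈ G, constantCoeff (E g) = 0)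
    (hgen : ∀ g ∈ G, θ (E g) = E' g) (hres : ∀ s : S, lam (constantCoeff (E s)) = constantCoeff (E' s)) (s : S) :
    θ (E s) = E' s := by
  have := ringHom_comp_eq_of_generators p E E' θ lam hperf hθC hθm G hG hE0 hgen hres
  rw [← this, RingHom.comp_apply]

end Summit.ResolutionOfSingularities.ResolutionOfSingularities.Theorems.SwitchingDichotomy.ExpansionTransport

end
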